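import Mathlib.LinearAlgebra.PerfectPairing.Basic
import Mathlib.Algebra.Module.Torsion.Basic
import Mathlib.LinearAlgebra.Quotient.Bilinear
import Mathlib.LinearAlgebra.Dimension.Finrank
import Mathlib.LinearAlgebra.FreeModule.Basic
import Mathlib.LinearAlgebra.FreeModule.PID
import Mathlib.Geometry.Manifold.ChartedSpace
import Mathlib.Analysis.InnerProductSpace.PiL2
import Summits.Ventures.HodgeRepro2.HostAPI.Carriers.AlgebraicTopology.SingularHomology.CapProduct
import Summits.Ventures.HodgeRepro2.HostAPI.Carriers.AlgebraicTopology.SingularHomology.FundamentalClass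
import Summits.Ventures.HodgeRepro2.HostAPI.Util.ForallBinderLint
open HostAPI.Carriers

noncomputable section

open CategoryTheory Limits Topology nonZeroDivisors

universe u v

namespace HostAPI.Carriers.AlgebraicTopology.SingularHomology

variable {R : Type v} [CommRing R]
variable {X : Type u} [TopologicalSpace X]

section Torsion

variable {V W : Type*} [AddCommGroup V] [Module R V] [AddCommGroup W] [Module R W]

lemma bilinear_apply_eq_zero_of_mem_torsion (B : V →ₗ[R] W →ₗ[R] R) {x : V}
    (hx : x ∈ Submodule.torsion R V) (y : W) : B x y = 0 := by
  obtain ⟨⟨r, hr⟩, hrx⟩ := (Submodule.mem_torsion_iff x).mp hx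
  have h : r * B x y = 0 := by
    rw [← smul_eq_mul, ← LinearMap.smul_apply, ← map_smul]
    change B ((⟨r, hr⟩ : R⁰) • x) y = 0
    rw [hrx, map_zero, LinearMap.zero_apply]
  exact (mem_nonZeroDivisors_iff.mp hr).1 _ h

lemma bilinear_apply_eq_zero_of_mem_torsion_right (B : V →ₗ[R] W →ₗ[R] R) (x : V) {y : W}
    (hy : y ∈ Submodule.torsion R W) : B x y = 0 :=
  bilinear_apply_eq_zero_of_mem_torsion B.flip hy x

lemma torsion_le_ker_bilinear (B : V →ₗ[R] W →ₗ[R] R) :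
    Submodule.torsion R V ≤ LinearMap.ker B := fun _ hx ↦
  LinearMap.mem_ker.mpr (LinearMap.ext fun y ↦ bilinear_apply_eq_zero_of_mem_torsion B hx y)

lemma torsion_le_ker_bilinear_flip (B : V →ₗ[R] W →ₗ[R] R) :
    Submodule.torsion R W ≤ LinearMap.ker B.flip :=
  torsion_le_ker_bilinear B.flip

end Torsion

section Duality

variable {p q n : ℕ}

def poincareDualityMap (μ : HomologicalOrientation R X n) (h : p + q = n) :
    singularCohomology R R X p →ₗ[R] singularHomology R R X q :=
  (capProduct (M := R) h).flip μ.fundamentalClass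

@[simp]
lemma poincareDualityMap_apply (μ : HomologicalOrientation R X n) (h : p + q = n)
    (a : singularCohomology R R X p) :
    poincareDualityMap μ h a = capProduct h a μ.fundamentalClass :=
  rfl

def bijective_poincareDualityMap [CompactSpace X] [T2Space X]
    [ChartedSpace (EuclideanSpace ℝ (Fin n)) X] (μ : HomologicalOrientation R X n)
    (h : p + q = n) : Prop :=
  Function.Bijective (poincareDualityMap μ h)

def poincareDualityEquiv [CompactSpace X] [T2Space X]
    [ChartedSpace (EuclideanSpace ℝ (Fin n)) X] (μ : HomologicalOrientation R X n)
    (h : p + q = n) (hD : bijective_poincareDualityMap μ h) :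
    singularCohomology R R X p ≃ₗ[R] singularHomology R R X q :=
  LinearEquiv.ofBijective (poincareDualityMap μ h) hD

@[simp]
lemma poincareDualityEquiv_apply [CompactSpace X] [T2Space X]
    [ChartedSpace (EuclideanSpace ℝ (Fin n)) X] (μ : HomologicalOrientation R X n)
    (h : p + q = n) (hD : bijective_poincareDualityMap μ h) (a : singularCohomology R R X p) :
    poincareDualityEquiv μ h hD a = poincareDualityMap μ h a :=
  rfl

def cupPairing (μ : HomologicalOrientation R X n) (h : p + q = n) :
    singularCohomology R R X p →ₗ[R] singularCohomology R R X q →ₗ[R] R :=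
  (cupProduct h).compr₂ ((kroneckerPairing R R X n).flip μ.fundamentalClass)

@[simp]
lemma cupPairing_apply (μ : HomologicalOrientation R X n) (h : p + q = n)
    (a : singularCohomology R R X p) (b : singularCohomology R R X q) :
    cupPairing μ h a b = kroneckerPairing R R X n (cupProduct h a b) μ.fundamentalClass :=
  rfl

lemma cupPairing_eq_kroneckerPairing_poincareDualityMap (μ : HomologicalOrientation R X n)
    (h : p + q = n) (a : singularCohomology R R X p) (b : singularCohomology R R X q) :
    cupPairing μ h a b = kroneckerPairing R R X q b (poincareDualityMap μ h a) := by
  rw [cupPairing_apply, poincareDualityMap_apply, kroneckerPairing_cupProduct]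

theorem cupPairing_flip (hc : cupProduct_gradedComm R X) (μ : HomologicalOrientation R X n)
    (h : p + q = n) (h' : q + p = n) :
    (cupPairing μ h).flip = ((-1 : R) ^ (p * q)) • cupPairing μ h' := by
  ext b a
  rw [LinearMap.flip_apply, LinearMap.smul_apply, LinearMap.smul_apply, cupPairing_apply,
    cupPairing_apply, hc h h', map_smul, LinearMap.smul_apply]

end Duality

section Field

variable {K : Type v} [Field K] {p q n : ℕ}

def isPerfPair_cupPairing_of_field [CompactSpace X] [T2Space X]
    [ChartedSpace (EuclideanSpace ℝ (Fin n)) X] (μ : HomologicalOrientation K X n)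
    (h : p + q = n) : Prop :=
  (cupPairing μ h).IsPerfPair

end Field

section Free

variable (R X) in

def freeCohomology (k : ℕ) : ModuleCat.{max u v} R :=
  ModuleCat.of R
    (↥(singularCohomology R R X k) ⧸ Submodule.torsion R ↥(singularCohomology R R X k))

namespace freeCohomology

variable {k : ℕ}

def mk : singularCohomology R R X k →ₗ[R] freeCohomology R X k :=
  (Submodule.torsion R ↥(singularCohomology R R X k)).mkQ

lemma mk_apply (a : singularCohomology R R X k) :
    (mk a : freeCohomology R X k) = Submodule.Quotient.mk a :=
  rfl

lemma mk_surjective : Function.Surjective (mk : singularCohomology R R X k →ₗ[R] _) :=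
  Submodule.mkQ_surjective _

@[simp]
lemma ker_mk : LinearMap.ker (mk : singularCohomology R R X k →ₗ[R] _) =
    Submodule.torsion R ↥(singularCohomology R R X k) :=
  Submodule.ker_mkQ _

lemma mk_eq_zero_iff (a : singularCohomology R R X k) :
    (mk a : freeCohomology R X k) = 0 ↔ a ∈ Submodule.torsion R ↥(singularCohomology R R X k) := by
  rw [← LinearMap.mem_ker, ker_mk]

@[elab_as_elim]
theorem induction_on {C : freeCohomology R X k → Prop} (x : freeCohomology R X k)
    (h : ∀ a : singularCohomology R R X k, C (mk a)) : C x := by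
  obtain ⟨a, rfl⟩ := mk_surjective x
  exact h a

end freeCohomology

example (X : Type u) [TopologicalSpace X] (k : ℕ) :
    (inferInstance : Module ℤ ↥(freeCohomology ℤ X k)) = (freeCohomology ℤ X k).isModule :=
  rfl

example (X : Type u) [TopologicalSpace X] (k : ℕ) :
    Module.Free ℤ ↥(freeCohomology ℤ X k) → True :=
  fun _ ↦ trivial

variable {p q n : ℕ}

def cupPairingModTorsion (μ : HomologicalOrientation R X n) (h : p + q = n) :
    freeCohomology R X p →ₗ[R] freeCohomology R X q →ₗ[R] R :=
  (cupPairing μ h).liftQ₂ _ _ (torsion_le_ker_bilinear _) (torsion_le_ker_bilinear_flip _)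

@[simp]
lemma cupPairingModTorsion_mk_mk (μ : HomologicalOrientation R X n) (h : p + q = n)
    (a : singularCohomology R R X p) (b : singularCohomology R R X q) :
    cupPairingModTorsion μ h (freeCohomology.mk a) (freeCohomology.mk b) = cupPairing μ h a b :=
  rfl

theorem cupPairingModTorsion_flip (hc : cupProduct_gradedComm R X) (μ : HomologicalOrientation R X n)
    (h : p + q = n) (h' : q + p = n) :
    (cupPairingModTorsion μ h).flip = ((-1 : R) ^ (p * q)) • cupPairingModTorsion μ h' := by
  ext y x
  induction x using freeCohomology.induction_on with
  | h a =>
    induction y using freeCohomology.induction_on with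
    | h b =>
      rw [LinearMap.flip_apply, LinearMap.smul_apply, LinearMap.smul_apply,
        cupPairingModTorsion_mk_mk, cupPairingModTorsion_mk_mk, ← LinearMap.smul_apply,
        ← LinearMap.smul_apply, ← cupPairing_flip hc μ h h', LinearMap.flip_apply]

def isPerfPair_cupPairingModTorsion [IsDomain R] [IsPrincipalIdealRing R] [CompactSpace X]
    [T2Space X] [ChartedSpace (EuclideanSpace ℝ (Fin n)) X] (μ : HomologicalOrientation R X n)
    (h : p + q = n) : Prop :=
  (cupPairingModTorsion μ h).IsPerfPair

end Free

section Finiteness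

variable {n : ℕ}

variable (R X) in

def finite_singularHomology_of_compactSpace (n : ℕ) [IsNoetherianRing R] [CompactSpace X]
    [T2Space X] [ChartedSpace (EuclideanSpace ℝ (Fin n)) X] (k : ℕ) : Prop :=
  Module.Finite R (singularHomology R R X k)

variable (R X) in

def finite_singularCohomology_of_compactSpace (n : ℕ) [IsNoetherianRing R] [CompactSpace X]
    [T2Space X] [ChartedSpace (EuclideanSpace ℝ (Fin n)) X] (k : ℕ) : Prop :=
  Module.Finite R (singularCohomology R R X k)

theorem finite_freeCohomology [IsNoetherianRing R] [CompactSpace X] [T2Space X]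
    [ChartedSpace (EuclideanSpace ℝ (Fin n)) X] {k : ℕ}
    (h : finite_singularCohomology_of_compactSpace R X n k) :
    Module.Finite R (freeCohomology R X k) := by
  unfold finite_singularCohomology_of_compactSpace at h
  exact Module.Finite.quotient R _

theorem free_freeCohomology [IsDomain R] [IsPrincipalIdealRing R] [CompactSpace X] [T2Space X]
    [ChartedSpace (EuclideanSpace ℝ (Fin n)) X] {k : ℕ}
    (h : finite_singularCohomology_of_compactSpace R X n k) :
    Module.Free R (freeCohomology R X k) := by
  haveI := finite_freeCohomology h
  haveI : Module.IsTorsionFree R (freeCohomology R X k) :=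
    inferInstanceAs (Module.IsTorsionFree R
      (singularCohomology R R X k ⧸ Submodule.torsion R (singularCohomology R R X k)))
  exact Module.free_of_finite_type_torsion_free'

variable (R X) in

def bettiNumber (k : ℕ) : ℕ :=
  Module.finrank R (singularHomology R R X k)

def bettiNumber_eq_bettiNumber_of_add_eq (K : Type v) [Field K] (X : Type u) [TopologicalSpace X]
    (n : ℕ) [CompactSpace X] [T2Space X] [ChartedSpace (EuclideanSpace ℝ (Fin n)) X] : Prop :=
  Nonempty (HomologicalOrientation K X n) →
    ∀ ⦃p q : ℕ⦄, p + q = n → bettiNumber K X p = bettiNumber K X q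

variable (R X n) in

def nonempty_singularCohomology_top_equiv [CompactSpace X] [T2Space X]
    [ChartedSpace (EuclideanSpace ℝ (Fin n)) X] [ConnectedSpace X] : Prop :=
  Nonempty (HomologicalOrientation R X n) → Nonempty (singularCohomology R R X n ≃ₗ[R] R)

end Finiteness

end HostAPI.Carriers.AlgebraicTopology.SingularHomology
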